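import Summits.AtomisticToContinuum.BoseEinsteinCondensation.Theorems.BECSubharmonicContinuationFourierRepresentationCell

/-!
# Route BECSubharmonicContinuation — support `FourierRepresentation`

Item stmt-AtomisticToContinuum-9001 of route-AtomisticToContinuum-BECSubharmonicContinuation
(sub-problem BoseEinsteinCondensation): the **momentum representation of the translation-averaged
one-body density matrix and of its gradient–gradient correlation** on the torus of side `L`.
For a periodic trial state `Ψ` of `N` bosons, every particle `i` and every `y ∈ ℝ³`,

* `N · G_Ψ(i,y) = ∑_{m ∈ ℤ³} n_m cos(2π m·y/L)`,
* `N · H_Ψ(i,y) = ∑_{m ∈ ℤ³} (2π/L)² |m|² n_m cos(2π m·y/L)`,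

as convergent sums (`HasSum`), where `G_Ψ(i,y) = Re ∫_{cell^N} conj Ψ(X^{i → xᵢ+y}) Ψ(X) dX`,
`H_Ψ(i,y) = Re ∑ₖ ∫_{cell^N} conj ∂_{i,k}Ψ(X^{i → xᵢ+y}) ∂_{i,k}Ψ(X) dX`, and `n_m` is the
`cellOccupation` of the normalised plane wave `L^{-3/2} e^{2πi m·x/L}` (`fourierRepresentation_proof`).

Proof (classical torus Fourier analysis): Bose symmetry moves slot `i` to slot `0`; Fubini splits
`cell^{n+1} = cell × cell^n`; for every spectator configuration `Y` the polarised Parseval identity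
for the translate `x ↦ Φ(x+y, Y)` against `x ↦ Φ(x, Y)` in `L²` of the cell (cell toolkit,
`hasSum_normSq_cellFourierCoeff_mul_cos`) gives `L⁻³ Re ∫ conj Φ(x+y,Y) Φ(x,Y) dx =
∑ₘ |ĉₘ(Y)|² cos(2π m·y/L)` for EVERY `y`; the series is integrated in `Y` termwise
(`hasSum_integral_of_summable_integral_norm`), the norms being summable because
`∑ₘ n_m = (n+1)∫|Φ|² < ∞` (`tsum_cellOccupation_planeWaveMode_eq`) — the abstract slot-`0` identity
`hasSum_cellOccupation_mul_cos_slot_zero` for every continuous `Φ` with periodic slices. For `H`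
apply it to `Φ = ∂_{0,k}Ψ`, whose occupations add up to `|2πm/L|² n_m` mode by mode
(`sum_cellOccupation_fderiv_eq`). References: [LSSY2005, §1.2 (1.16)–(1.18)],
[Fournais2020, (1.3)–(1.5), (3.19)–(3.21)].
-/

noncomputable section

open MeasureTheory Filter Set WithLp Complex
open scoped ENNReal NNReal Topology ComplexConjugate BigOperators

namespace Summit.AtomisticToContinuum.BoseEinsteinCondensation.Theorems

open Literature.MathematicalPhysics.QuantumManyBody.BoseGas

namespace SubharmonicContinuation

/-! ### The core identity in slot `0` -/

section Core

variable {n : ℕ} {L : ℝ}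

/-- **The core identity (slot `0`, abstract form).** For a continuous `(n+1)`-body function `Φ`
whose slices `x ↦ Φ(x, Y)` are `Lℤ³`-periodic, and every `y ∈ ℝ³`,
`∑ₘ ⟨φ_m, γ_Φ φ_m⟩ cos(2π m·y/L) = (n+1) Re ∫_{Ω^{n+1}} conj Φ(X^{0 → x₀+y}) Φ(X) dX` as a
convergent sum: per-`Y` polarised Parseval for the translate, Fubini, and termwise integration of
the series (norms summable by `tr γ_Φ < ∞`). [cite: LSSY2005, §1.2 (1.17)–(1.18)] -/
theorem hasSum_cellOccupation_mul_cos_slot_zero (hL : 0 < L) {Φ : Config (n + 1) → ℂ}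
    (hΦ : Continuous Φ)
    (hper : ∀ (Y : Config n) (x : Space) (k : Fin 3),
      Φ (Matrix.vecCons (x + EuclideanSpace.single k L) Y) = Φ (Matrix.vecCons x Y))
    (y : Space) :
    HasSum (fun m : Fin 3 → ℤ => (cellOccupation (n + 1) L (planeWaveMode L m) Φ).toReal *
        Real.cos (2 * Real.pi * (∑ k : Fin 3, (m k : ℝ) * y k) / L))
      (((n + 1 : ℕ) : ℝ) *
        (∫ X in cellN (n + 1) L, conj (Φ (Function.update X 0 (X 0 + y))) * Φ X).re) := by
  -- abbreviations
  set c : (Fin 3 → ℤ) → Config n → ℂ := fun m Y =>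
    cellFourierCoeff L (fun x => Φ (Matrix.vecCons x Y)) m with hc
  set θ : (Fin 3 → ℤ) → ℝ := fun m => 2 * Real.pi * (∑ k : Fin 3, (m k : ℝ) * y k) / L with hθ
  set I : (Fin 3 → ℤ) → ℝ≥0∞ := fun m => ∫⁻ Y in cellN n L, (‖c m Y‖₊ : ℝ≥0∞) ^ 2 with hI
  have hL3 : (0 : ℝ) < L ^ 3 := by positivity
  have hL3e : ENNReal.ofReal L ^ 3 ≠ 0 := pow_ne_zero _ (by simpa using hL)
  have hn1 : (n + 1 : ℝ≥0∞) ≠ 0 := by simp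
  have hupd : ∀ (Y : Config n) (x z : Space),
      Function.update (Matrix.vecCons x Y) 0 z = Matrix.vecCons z Y := fun Y x z =>
    Fin.update_cons_zero (α := fun _ => Space) x Y z
  have hsl : ∀ Y : Config n, Continuous fun x => Φ (Matrix.vecCons x Y) := fun Y =>
    hΦ.comp (continuous_id.matrixVecCons continuous_const)
  -- (1) the occupations through the slice coefficients, finiteness, measurability
  have hocc : ∀ m, cellOccupation (n + 1) L (planeWaveMode L m) Φ =
      (n + 1 : ℝ≥0∞) * (ENNReal.ofReal L ^ 3 * I m) := fun m =>
    cellOccupation_planeWaveMode_eq_lintegral_coeff hL Φ m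
  have hocc_top : ∀ m, cellOccupation (n + 1) L (planeWaveMode L m) Φ ≠ ⊤ := fun m =>
    cellOccupation_planeWaveMode_ne_top hL hΦ m
  have hI_top : ∀ m, I m ≠ ⊤ := by
    intro m htop
    apply hocc_top m
    rw [hocc m, htop, ENNReal.mul_top hL3e, ENNReal.mul_top hn1]
  have hc_sm : ∀ m, StronglyMeasurable (c m) := by
    intro m
    have h := (stronglyMeasurable_sliceInner L (contDiff_cellWave L m).continuous hΦ).const_smul
      ((L ^ 3)⁻¹ : ℝ)
    have hfun : c m = fun Y => ((L ^ 3)⁻¹ : ℝ) •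
        ∫ x in cell L, conj (cellWave L m x) * Φ (Matrix.vecCons x Y) :=
      funext fun Y => cellFourierCoeff_eq_integral hL _ m
    rw [hfun]
    exact h
  have hc2_meas : ∀ m, AEStronglyMeasurable (fun Y => ‖c m Y‖ ^ 2)
      (volume.restrict (cellN n L)) := fun m =>
    ((hc_sm m).measurable.norm.pow_const 2).aestronglyMeasurable
  have hlin : ∀ m, ∫⁻ Y in cellN n L, ENNReal.ofReal (‖c m Y‖ ^ 2) = I m := fun m =>
    lintegral_congr fun Y => (coe_nnnorm_sq_eq_ofReal (c m Y)).symm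
  have hc2_int : ∀ m, Integrable (fun Y => ‖c m Y‖ ^ 2) (volume.restrict (cellN n L)) := by
    intro m
    refine ⟨hc2_meas m, (hasFiniteIntegral_iff_ofReal (Eventually.of_forall fun Y => ?_)).2 ?_⟩
    · exact sq_nonneg _
    · rw [hlin]; exact (hI_top m).lt_top
  have hc2_eq : ∀ m, ∫ Y in cellN n L, ‖c m Y‖ ^ 2 = (I m).toReal := by
    intro m
    rw [integral_eq_lintegral_of_nonneg_ae (Eventually.of_forall fun Y => sq_nonneg _) (hc2_meas m),
      hlin]
  have hocc_real : ∀ m, (cellOccupation (n + 1) L (planeWaveMode L m) Φ).toReal =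
      ((n + 1 : ℕ) : ℝ) * (L ^ 3 * (I m).toReal) := by
    intro m
    rw [hocc m, ENNReal.toReal_mul, ENNReal.toReal_mul, ENNReal.toReal_pow,
      ENNReal.toReal_ofReal hL.le]
    congr 1
    norm_cast
  -- (2) the correlation integrand in slice form, Fubini
  set K : Config (n + 1) → ℂ := fun X => conj (Φ (Function.update X 0 (X 0 + y))) * Φ X with hK
  have hKcont : Continuous K :=
    (Complex.continuous_conj.comp (hΦ.comp
      (continuous_id.update 0 ((continuous_apply 0).add continuous_const)))).mul hΦ
  have hKcons : ∀ (Y : Config n) (x : Space), K (Matrix.vecCons x Y) =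
      conj (Φ (Matrix.vecCons (x + y) Y)) * Φ (Matrix.vecCons x Y) := by
    intro Y x
    simp only [hK, Matrix.cons_val_zero, hupd]
  have hFub : ∫ X in cellN (n + 1) L, K X =
      ∫ Y in cellN n L, ∫ x in cell L, K (Matrix.vecCons x Y) :=
    setIntegral_cellN_succ_right_of_continuous hKcont
  have hKint : Integrable (fun Y => ∫ x in cell L, K (Matrix.vecCons x Y))
      (volume.restrict (cellN n L)) :=
    (integrable_comp_vecCons_prod_restrict (L := L) hKcont).integral_prod_right
  have hre : ∫ Y in cellN n L, (∫ x in cell L, K (Matrix.vecCons x Y)).re =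
      (∫ X in cellN (n + 1) L, K X).re := by
    rw [hFub]
    have h := integral_re hKint
    simpa only [RCLike.re_to_complex] using h
  -- (3) per-`Y` Parseval
  set B : (Fin 3 → ℤ) → ℝ := fun m => ((n + 1 : ℕ) : ℝ) * L ^ 3 * Real.cos (θ m) with hB
  have hY : ∀ Y : Config n, HasSum (fun m => B m * ‖c m Y‖ ^ 2)
      (((n + 1 : ℕ) : ℝ) * (∫ x in cell L, K (Matrix.vecCons x Y)).re) := by
    intro Y
    have h := (hasSum_normSq_cellFourierCoeff_mul_cos hL (hsl Y) (hper Y) y).mul_left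
      (((n + 1 : ℕ) : ℝ) * L ^ 3)
    have hfun : (fun m => B m * ‖c m Y‖ ^ 2) = fun m => ((n + 1 : ℕ) : ℝ) * L ^ 3 *
        (‖cellFourierCoeff L (fun x => Φ (Matrix.vecCons x Y)) m‖ ^ 2 *
          Real.cos (2 * Real.pi * (∑ k : Fin 3, (m k : ℝ) * y k) / L)) := by
      funext m
      simp only [hB, hc, hθ]
      ring
    have hval : ((n + 1 : ℕ) : ℝ) * (∫ x in cell L, K (Matrix.vecCons x Y)).re =
        ((n + 1 : ℕ) : ℝ) * L ^ 3 * ((L ^ 3)⁻¹ *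
          (∫ x in cell L, conj (Φ (Matrix.vecCons (x + y) Y)) * Φ (Matrix.vecCons x Y)).re) := by
      simp only [hKcons]
      rw [mul_assoc, ← mul_assoc (L ^ 3), mul_inv_cancel₀ hL3.ne', one_mul]
    rw [hfun, hval]
    exact h
  -- (4) termwise integrals and summability of the norms
  have hS_int : ∀ m, Integrable (fun Y => B m * ‖c m Y‖ ^ 2) (volume.restrict (cellN n L)) :=
    fun m => (hc2_int m).const_mul (B m)
  have hS_eq : ∀ m, ∫ Y in cellN n L, B m * ‖c m Y‖ ^ 2 =
      (cellOccupation (n + 1) L (planeWaveMode L m) Φ).toReal * Real.cos (θ m) := by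
    intro m
    rw [integral_const_mul, hc2_eq m, hocc_real m, hB]
    ring
  have hnorm_eq : ∀ m, ∫ Y in cellN n L, ‖B m * ‖c m Y‖ ^ 2‖ = |B m| * (I m).toReal := by
    intro m
    have : (fun Y => ‖B m * ‖c m Y‖ ^ 2‖) = fun Y => |B m| * ‖c m Y‖ ^ 2 := by
      funext Y
      rw [Real.norm_eq_abs, abs_mul, abs_of_nonneg (sq_nonneg ‖c m Y‖)]
    rw [this, integral_const_mul, hc2_eq m]
  have hsum_occ : Summable fun m => (cellOccupation (n + 1) L (planeWaveMode L m) Φ).toReal := by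
    refine ENNReal.summable_toReal ?_
    rw [tsum_cellOccupation_planeWaveMode_eq hL hΦ]
    exact ENNReal.mul_ne_top (ENNReal.natCast_ne_top _) (lintegral_cellN_sq_lt_top L hΦ).ne
  have hsum_norm : Summable fun m => ∫ Y in cellN n L, ‖B m * ‖c m Y‖ ^ 2‖ := by
    refine Summable.of_nonneg_of_le (fun m => integral_nonneg fun Y => norm_nonneg _)
      (fun m => ?_) hsum_occ
    rw [hnorm_eq m, hocc_real m]
    have hcos : |Real.cos (θ m)| ≤ 1 := Real.abs_cos_le_one _
    have hBle : |B m| ≤ ((n + 1 : ℕ) : ℝ) * L ^ 3 := by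
      rw [hB]
      simp only
      rw [abs_mul, abs_of_nonneg (by positivity : (0 : ℝ) ≤ ((n + 1 : ℕ) : ℝ) * L ^ 3)]
      exact mul_le_of_le_one_right (by positivity) hcos
    calc |B m| * (I m).toReal ≤ ((n + 1 : ℕ) : ℝ) * L ^ 3 * (I m).toReal :=
          mul_le_mul_of_nonneg_right hBle ENNReal.toReal_nonneg
      _ = ((n + 1 : ℕ) : ℝ) * (L ^ 3 * (I m).toReal) := by ring
  -- (5) integrate the series termwise
  have hmain := hasSum_integral_of_summable_integral_norm hS_int hsum_norm
  have htsum : ∀ Y : Config n, ∑' m, B m * ‖c m Y‖ ^ 2 =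
      ((n + 1 : ℕ) : ℝ) * (∫ x in cell L, K (Matrix.vecCons x Y)).re := fun Y => (hY Y).tsum_eq
  simp only [hS_eq, htsum] at hmain
  rw [integral_const_mul, hre] at hmain
  exact hmain

/-- **Slot `0`, density matrix**: `∑ₘ n_m cos(2π m·y/L) = N Re ∫ conj Ψ(X^{0 → x₀+y}) Ψ(X)` for a
periodic trial state of `N = n+1` bosons. [cite: LSSY2005, §1.2 (1.17)–(1.18)] -/
theorem hasSum_cellOccupation_mul_cos_G (hL : 0 < L) (Ψ : PeriodicTrialState (n + 1) L)
    (y : Space) :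
    HasSum (fun m : Fin 3 → ℤ => (cellOccupation (n + 1) L (planeWaveMode L m) Ψ.ψ).toReal *
        Real.cos (2 * Real.pi * (∑ k : Fin 3, (m k : ℝ) * y k) / L))
      (((n + 1 : ℕ) : ℝ) *
        (∫ X in cellN (n + 1) L, conj (Ψ.ψ (Function.update X 0 (X 0 + y))) * Ψ.ψ X).re) := by
  have hupd : ∀ (Y : Config n) (x z : Space),
      Function.update (Matrix.vecCons x Y) 0 z = Matrix.vecCons z Y := fun Y x z =>
    Fin.update_cons_zero (α := fun _ => Space) x Y z
  refine hasSum_cellOccupation_mul_cos_slot_zero hL Ψ.contDiff.continuous (fun Y x k => ?_) y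
  simpa only [hupd] using Ψ.periodic_slice (Matrix.vecCons 0 Y) 0 x k

/-- **The kinetic occupations, mode by mode**: `∑ₖ ⟨φ_m, γ_{∂_{0,k}Ψ} φ_m⟩ = |2πm/L|² ⟨φ_m, γ_Ψ φ_m⟩`
for a periodic trial state (the derivative rule `ĉ_m(∂ₖf) = (2πi m_k/L) ĉ_m(f)` on each slice).
[cite: LSSY2005, §1.2 (1.16)–(1.17)] -/
theorem sum_cellOccupation_fderiv_eq (hL : 0 < L) (Ψ : PeriodicTrialState (n + 1) L)
    (m : Fin 3 → ℤ) :
    ∑ k : Fin 3, cellOccupation (n + 1) L (planeWaveMode L m)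
        (fun X => fderiv ℝ Ψ.ψ X (Pi.single 0 (EuclideanSpace.single k 1))) =
      fracDispersion 2 L m * cellOccupation (n + 1) L (planeWaveMode L m) Ψ.ψ := by
  have hdiff : Differentiable ℝ Ψ.ψ := Ψ.contDiff.differentiable one_ne_zero
  have hL3e' : ENNReal.ofReal L ^ 3 ≠ ⊤ := ENNReal.pow_ne_top ENNReal.ofReal_ne_top
  have hupd : ∀ (Y : Config n) (x z : Space),
      Function.update (Matrix.vecCons x Y) 0 z = Matrix.vecCons z Y := fun Y x z =>
    Fin.update_cons_zero (α := fun _ => Space) x Y z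
  have hC1 : ∀ Y : Config n, ContDiff ℝ 1 fun x => Ψ.ψ (Matrix.vecCons x Y) := fun Y => by
    simpa only [hupd] using Ψ.contDiff_slice (Matrix.vecCons 0 Y) 0
  have hperY : ∀ (Y : Config n) (x : Space) (k : Fin 3),
      Ψ.ψ (Matrix.vecCons (x + EuclideanSpace.single k L) Y) = Ψ.ψ (Matrix.vecCons x Y) :=
    fun Y x k => by simpa only [hupd] using Ψ.periodic_slice (Matrix.vecCons 0 Y) 0 x k
  have hslice_fd : ∀ (k : Fin 3) (Y : Config n),
      (fun x => fderiv ℝ Ψ.ψ (Matrix.vecCons x Y) (Pi.single 0 (EuclideanSpace.single k 1))) =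
        fun x => fderiv ℝ (fun z => Ψ.ψ (Matrix.vecCons z Y)) x (EuclideanSpace.single k 1) := by
    intro k Y
    funext x
    have h := fderiv_slice_apply hdiff (Matrix.vecCons 0 Y) 0 x k
    simp only [hupd] at h
    exact h.symm
  -- the slice coefficients of `Ψ`
  set c : Config n → ℂ := fun Y => cellFourierCoeff L (fun x => Ψ.ψ (Matrix.vecCons x Y)) m with hc
  have hc_meas : Measurable fun Y => (‖c Y‖₊ : ℝ≥0∞) ^ 2 := by
    have h := (stronglyMeasurable_sliceInner L (contDiff_cellWave L m).continuous
      Ψ.contDiff.continuous).const_smul ((L ^ 3)⁻¹ : ℝ)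
    have hfun : c = fun Y => ((L ^ 3)⁻¹ : ℝ) •
        ∫ x in cell L, conj (cellWave L m x) * Ψ.ψ (Matrix.vecCons x Y) :=
      funext fun Y => cellFourierCoeff_eq_integral hL _ m
    rw [hfun]
    exact h.measurable.nnnorm.coe_nnreal_ennreal.pow_const _
  calc ∑ k : Fin 3, cellOccupation (n + 1) L (planeWaveMode L m)
        (fun X => fderiv ℝ Ψ.ψ X (Pi.single 0 (EuclideanSpace.single k 1)))
      = ∑ k : Fin 3, (n + 1 : ℝ≥0∞) * (ENNReal.ofReal L ^ 3 * ∫⁻ Y in cellN n L,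
          ENNReal.ofReal (4 * Real.pi ^ 2 * (m k : ℝ) ^ 2 / L ^ 2) * (‖c Y‖₊ : ℝ≥0∞) ^ 2) := by
        refine Finset.sum_congr rfl fun k _ => ?_
        rw [cellOccupation_planeWaveMode_eq_lintegral_coeff hL]
        congr 2
        refine lintegral_congr fun Y => ?_
        rw [hslice_fd k Y]
        exact nnnorm_sq_cellFourierCoeff_fderiv hL (hC1 Y) (hperY Y) k m
    _ = (n + 1 : ℝ≥0∞) * (ENNReal.ofReal L ^ 3 *
          ∫⁻ Y in cellN n L, fracDispersion 2 L m * (‖c Y‖₊ : ℝ≥0∞) ^ 2) := by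
        rw [← Finset.mul_sum, ← Finset.mul_sum, ← lintegral_finsetSum _ fun k _ =>
          (hc_meas.const_mul _)]
        congr 2
        refine lintegral_congr fun Y => ?_
        rw [← Finset.sum_mul, fracDispersion_two,
          ← ENNReal.ofReal_sum_of_nonneg (fun k _ => by positivity)]
        congr 2
        rw [Finset.mul_sum, Finset.sum_div]
    _ = fracDispersion 2 L m * cellOccupation (n + 1) L (planeWaveMode L m) Ψ.ψ := by
        rw [cellOccupation_planeWaveMode_eq_lintegral_coeff hL,
          lintegral_const_mul' _ _ (fracDispersion_ne_top 2 L m)]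
        ring

/-- **Slot `0`, kinetic coherence**:
`∑ₘ (2π/L)²|m|² n_m cos(2π m·y/L) = N Re ∑ₖ ∫ conj ∂_{0,k}Ψ(X^{0 → x₀+y}) ∂_{0,k}Ψ(X)` for a
periodic trial state of `N = n+1` bosons. [cite: LSSY2005, §1.2 (1.16)–(1.18)] -/
theorem hasSum_cellOccupation_mul_cos_H (hL : 0 < L) (Ψ : PeriodicTrialState (n + 1) L)
    (y : Space) :
    HasSum (fun m : Fin 3 → ℤ => (2 * Real.pi / L) ^ 2 * (∑ k : Fin 3, (m k : ℝ) ^ 2) *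
        (cellOccupation (n + 1) L (planeWaveMode L m) Ψ.ψ).toReal *
          Real.cos (2 * Real.pi * (∑ k : Fin 3, (m k : ℝ) * y k) / L))
      (((n + 1 : ℕ) : ℝ) * (∑ k : Fin 3, ∫ X in cellN (n + 1) L,
        conj (fderiv ℝ Ψ.ψ (Function.update X 0 (X 0 + y))
          (Pi.single 0 (EuclideanSpace.single k 1))) *
            fderiv ℝ Ψ.ψ X (Pi.single 0 (EuclideanSpace.single k 1))).re) := by
  -- the three derivative functions `Φ k = ∂_{0,k}Ψ`: continuous with periodic slices
  set Φ : Fin 3 → Config (n + 1) → ℂ := fun k X =>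
    fderiv ℝ Ψ.ψ X (Pi.single 0 (EuclideanSpace.single k 1)) with hΦ
  have hΦc : ∀ k, Continuous (Φ k) := fun k => continuous_fderiv_config_single Ψ.contDiff 0 k
  have hΦper : ∀ (k : Fin 3) (Y : Config n) (x : Space) (k' : Fin 3),
      Φ k (Matrix.vecCons (x + EuclideanSpace.single k' L) Y) = Φ k (Matrix.vecCons x Y) := by
    intro k Y x k'
    simp only [hΦ, vecCons_add_left x (EuclideanSpace.single k' L) Y, fderiv_periodic_add_single Ψ]
  have hA : ∀ k, HasSum (fun m : Fin 3 → ℤ =>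
      (cellOccupation (n + 1) L (planeWaveMode L m) (Φ k)).toReal *
        Real.cos (2 * Real.pi * (∑ j : Fin 3, (m j : ℝ) * y j) / L))
      (((n + 1 : ℕ) : ℝ) *
        (∫ X in cellN (n + 1) L, conj (Φ k (Function.update X 0 (X 0 + y))) * Φ k X).re) :=
    fun k => hasSum_cellOccupation_mul_cos_slot_zero hL (hΦc k) (hΦper k) y
  have hsum := hasSum_sum (s := (Finset.univ : Finset (Fin 3))) fun k _ => hA k
  rw [← Finset.mul_sum, ← Complex.re_sum] at hsum
  refine hsum.congr_fun fun m => ?_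
  rw [← Finset.sum_mul, ← ENNReal.toReal_sum fun k _ =>
    cellOccupation_planeWaveMode_ne_top hL (hΦc k) m]
  rw [show (∑ k : Fin 3, cellOccupation (n + 1) L (planeWaveMode L m) (Φ k)) =
      fracDispersion 2 L m * cellOccupation (n + 1) L (planeWaveMode L m) Ψ.ψ from
    sum_cellOccupation_fderiv_eq hL Ψ m, ENNReal.toReal_mul, fracDispersion_two,
    ENNReal.toReal_ofReal (by positivity)]
  ring

end Core

/-! ### Bose symmetry: slot `i` to slot `0` -/

section Symmetry

variable {n : ℕ} {L : ℝ}

/-- Bose symmetry moves the translated slot of the density-matrix correlation to slot `0`.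
[folklore] -/
theorem setIntegral_corr_update_eq_slot_zero (Ψ : PeriodicTrialState (n + 1) L) (i : Fin (n + 1))
    (y : Space) :
    (∫ X in cellN (n + 1) L, conj (Ψ.ψ (Function.update X i (X i + y))) * Ψ.ψ X) =
      ∫ X in cellN (n + 1) L, conj (Ψ.ψ (Function.update X 0 (X 0 + y))) * Ψ.ψ X := by
  have hpt : ∀ X : Config (n + 1), conj (Ψ.ψ (Function.update X i (X i + y))) * Ψ.ψ X =
      (fun Z : Config (n + 1) => conj (Ψ.ψ (Function.update Z 0 (Z 0 + y))) * Ψ.ψ Z)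
        (X ∘ Equiv.swap 0 i) := by
    intro X
    simp only
    rw [Function.comp_apply, Equiv.swap_apply_left, ← update_comp_swap, Ψ.symm, Ψ.symm]
  simp_rw [hpt]
  exact Summit.AtomisticToContinuum.BoseEinsteinCondensation.Cruxes.GDTransfer.DysonDressedWitness.Lnss.setIntegral_cellN_comp_perm
    (Equiv.swap 0 i)
    (fun Z : Config (n + 1) => conj (Ψ.ψ (Function.update Z 0 (Z 0 + y))) * Ψ.ψ Z)

/-- Bose symmetry moves the translated slot of the gradient correlation to slot `0`.
[folklore] -/
theorem setIntegral_gradCorr_update_eq_slot_zero (Ψ : PeriodicTrialState (n + 1) L)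
    (i : Fin (n + 1)) (y : Space) (k : Fin 3) :
    (∫ X in cellN (n + 1) L, conj (fderiv ℝ Ψ.ψ (Function.update X i (X i + y))
        (Pi.single i (EuclideanSpace.single k 1))) *
          fderiv ℝ Ψ.ψ X (Pi.single i (EuclideanSpace.single k 1))) =
      ∫ X in cellN (n + 1) L, conj (fderiv ℝ Ψ.ψ (Function.update X 0 (X 0 + y))
        (Pi.single 0 (EuclideanSpace.single k 1))) *
          fderiv ℝ Ψ.ψ X (Pi.single 0 (EuclideanSpace.single k 1)) := by
  have hdiff : Differentiable ℝ Ψ.ψ := Ψ.contDiff.differentiable one_ne_zero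
  have hpt : ∀ X : Config (n + 1), conj (fderiv ℝ Ψ.ψ (Function.update X i (X i + y))
        (Pi.single i (EuclideanSpace.single k 1))) *
          fderiv ℝ Ψ.ψ X (Pi.single i (EuclideanSpace.single k 1)) =
      (fun Z : Config (n + 1) => conj (fderiv ℝ Ψ.ψ (Function.update Z 0 (Z 0 + y))
        (Pi.single 0 (EuclideanSpace.single k 1))) *
          fderiv ℝ Ψ.ψ Z (Pi.single 0 (EuclideanSpace.single k 1))) (X ∘ Equiv.swap 0 i) := by
    intro X
    simp only
    rw [Function.comp_apply, Equiv.swap_apply_left, ← update_comp_swap,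
      ← single_comp_swap i (EuclideanSpace.single k (1 : ℝ)),
      ← fderiv_comp_perm hdiff Ψ.symm, ← fderiv_comp_perm hdiff Ψ.symm]
  simp_rw [hpt]
  exact Summit.AtomisticToContinuum.BoseEinsteinCondensation.Cruxes.GDTransfer.DysonDressedWitness.Lnss.setIntegral_cellN_comp_perm
    (Equiv.swap 0 i)
    (fun Z : Config (n + 1) => conj (fderiv ℝ Ψ.ψ (Function.update Z 0 (Z 0 + y))
        (Pi.single 0 (EuclideanSpace.single k 1))) *
          fderiv ℝ Ψ.ψ Z (Pi.single 0 (EuclideanSpace.single k 1)))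

end Symmetry

end SubharmonicContinuation

open SubharmonicContinuation

/-! ### The route item -/

/-- **Route item `FourierRepresentation` (stmt-AtomisticToContinuum-9001).** For `L > 0`, every
periodic trial state `Ψ` of `N` particles, every particle `i` and every `y ∈ ℝ³`:
`N·G_Ψ(i,y) = ∑_{m∈ℤ³} n_m cos(2πm·y/L)` and `N·H_Ψ(i,y) = ∑_m (2π/L)²|m|² n_m cos(2πm·y/L)` as
convergent sums, `n_m` the occupation of the normalised plane wave `L^{-3/2} e^{2πim·x/L}`.
[cite: LSSY2005, §1.2 (1.17)–(1.18); Fournais2020, (1.3)–(1.5)] -/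
theorem fourierRepresentation_proof :
    Summit.AtomisticToContinuum.BoseEinsteinCondensation.Theses.BECSubharmonicContinuation.FourierRepresentation := by
  intro N L hL Ψ i y
  cases N with
  | zero => exact i.elim0
  | succ n =>
    beta_reduce
    -- the inlined normalised plane wave is `planeWaveMode`
    have hpw : ∀ m : Fin 3 → ℤ, cellOccupation (n + 1) L
        (fun x : EuclideanSpace ℝ (Fin 3) => ((Real.sqrt (L ^ 3))⁻¹ : ℂ) * cellWave L m x) Ψ.ψ =
          cellOccupation (n + 1) L (planeWaveMode L m) Ψ.ψ := fun m =>
      congrArg (fun φ => cellOccupation (n + 1) L φ Ψ.ψ)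
        (funext fun x => (planeWaveMode_eq L m x).symm)
    -- Bose symmetry: slot `i` to slot `0`
    rw [setIntegral_corr_update_eq_slot_zero Ψ i y]
    simp only [setIntegral_gradCorr_update_eq_slot_zero Ψ i y]
    refine ⟨(hasSum_cellOccupation_mul_cos_G hL Ψ y).congr_fun fun m => ?_,
      (hasSum_cellOccupation_mul_cos_H hL Ψ y).congr_fun fun m => ?_⟩
    · rw [hpw m]
    · rw [hpw m]

end Summit.AtomisticToContinuum.BoseEinsteinCondensation.Theorems

end
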